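import Mathlib

/-!
# Crux `GrenetZeon.TwoDimCoefficients` (stmt-ValiantsHypothesis-8062), stub `stub_dualUnipotent`:
# the CURVE-SELECTION ENGINE of the scaling-closure argument

The unipotent dual model (`DualUnipotentRepr n m`: `per_n = α·c + β·tr(adj A·B)`, `A, B` affine `m × m`,
`det A ≡ c ≠ 0`) escapes the Mignon–Ressayre Hessian test because `det A` has no zero.  The SCALING-CLOSURE
argument (memo `SIXTEENTH-HAND.md` on the item) restores a zero: for every complex `ε ≠ 0` the affine matrix
`A + ε B` has `det (A + εB) = c + ε·tr(adj A·B) + Σ_{k ≥ 2} ε^k D_k`, Mignon–Ressayre applies to it at each of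
ITS zeros, and along the rescaling `x = z/δ`, `ε = δ^n` the family `G_δ(z) = det(A + δ^n B)(z/δ)` tends (when
`deg D_k ≤ k·n`) to the SHADOW `Φ(z) = c + per_n(z)/β + Σ_{k≥2} [D_k]_{kn}(z)`; the inequality
`rank Hess ≤ 2m` on the zero set passes to the limit `δ → 0` PROVIDED every zero `z₀` of `Φ` at which one
wants to test the Hessian is a limit of zeros `(z_δ, δ)`, `δ ≠ 0`, of the family.  This file is that proviso,
in the form the argument needs (a point of `{F = F(a)}` off the hyperplane `{x_{i₀} = a_{i₀}}` inside any
prescribed neighbourhood, as soon as `∂F/∂x_j (a) ≠ 0` for some `j ≠ i₀`):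

* `exists_mem_nhds_off_coord` — ENGINE (any complete nontrivially normed field `𝕜`, finitely many coordinates):
  `F` strictly differentiable at `a` with `F'(e_j) ≠ 0`, `j ≠ i₀`, and `S ∈ 𝓝 a` ⟹ for all `δ ≠ a i₀` close
  enough to `a i₀` there is `x ∈ S` with `x i₀ = δ` and `F x = F a` (open-mapping form of the inverse function
  theorem, Mathlib `HasStrictFDerivAt.map_nhds_eq_of_surj`, applied to `x ↦ (F x, x i₀)`);
* `exists_off_coord_of_ne` — the pointwise corollary with an open condition `G x ≠ 0`;
* `hasDerivAt_eval_line`, `fderiv_eval_apply_single` — the Fréchet derivative of `x ↦ eval x P`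
  (`P : MvPolynomial ι ℂ`) in the coordinate direction `e_j` is `eval a (pderiv j P)`;
* ★ `exists_off_coord_mvPolynomial` — POLYNOMIAL FORM: `P, Q ∈ ℂ[x_ι]`, `eval a (pderiv j P) ≠ 0` (`j ≠ i₀`),
  `eval a Q ≠ 0` ⟹ `∃ x, x i₀ ≠ a i₀ ∧ eval x P = eval a P ∧ eval x Q ≠ 0`.

In the application `i₀` is the scaling parameter `δ`, `P` the rescaled determinant family, `a = (z₀, 0)` a
zero of the shadow with `∇Φ(z₀) ≠ 0`, and `Q` a `(2m+1)`-minor of the rescaled Hessian.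

HONEST FRAMING: an analytic instrument (curve selection at a smooth point); it proves nothing about the
permanent by itself; the stub `DualUnipotentBound`, the crux and `VP ≠ VNP` are untouched.

References: T. Mignon, N. Ressayre, Int. Math. Res. Not. 2004:79, Thm. 1.1 (the Hessian test this engine
transports to the limit); J. M. Landsberg, L. Manivel, N. Ressayre, Comment. Math. Helv. 88 (2013) 469–484,
§1 (closedness of Hessian-type conditions under degeneration — the border analogue; not used).
-/

-- single-conjunct layout `Summits/ValiantsHypothesis/ValiantsHypothesis`: the duplicated namespace
-- component is mandated by the tree.
set_option linter.dupNamespace false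
set_option autoImplicit false

noncomputable section

namespace Summit.ValiantsHypothesis.ValiantsHypothesis.Theorems.GrenetZeonTwoDimCoefficients.ScalingClosure

open Filter Topology

section Engine

variable {𝕜 : Type*} [NontriviallyNormedField 𝕜] [CompleteSpace 𝕜] {ι : Type*} [Fintype ι]
  [DecidableEq ι]

omit [CompleteSpace 𝕜] [Fintype ι] in
/-- The augmented differential `x ↦ (F'(x), x_{i₀})` is onto `𝕜 × 𝕜` as soon as `F'(e_j) ≠ 0` for some
coordinate `j ≠ i₀`. [folklore] -/
theorem range_prod_proj_eq_top (F' : (ι → 𝕜) →L[𝕜] 𝕜) {i₀ j : ι} (hj : j ≠ i₀)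
    (hFj : F' (Pi.single j 1) ≠ 0) :
    (F'.prod (ContinuousLinearMap.proj i₀ : (ι → 𝕜) →L[𝕜] 𝕜)).range = ⊤ := by
  refine LinearMap.range_eq_top.mpr fun y => ?_
  refine ⟨y.2 • Pi.single i₀ (1 : 𝕜) +
      ((y.1 - y.2 * F' (Pi.single i₀ 1)) / F' (Pi.single j 1)) • Pi.single j (1 : 𝕜), ?_⟩
  have h0 : (Pi.single j (1 : 𝕜) : ι → 𝕜) i₀ = 0 := by
    simp [hj.symm]
  refine Prod.ext ?_ ?_
  · simp only [ContinuousLinearMap.coe_coe, ContinuousLinearMap.prod_apply, map_add, map_smul,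
      Prod.fst_add, Prod.smul_fst, smul_eq_mul]
    field_simp
    ring
  · simp only [ContinuousLinearMap.coe_coe, ContinuousLinearMap.prod_apply,
      ContinuousLinearMap.proj_apply, Pi.add_apply, Pi.smul_apply, smul_eq_mul, h0, mul_zero,
      add_zero, Pi.single_eq_same, mul_one]

/-- **ENGINE (curve selection at a smooth point, filter form).**  Let `F : 𝕜^ι → 𝕜` be strictly
differentiable at `a` with `F'(e_j) ≠ 0` for a coordinate `j ≠ i₀`, and let `S` be a neighbourhood of `a`.
Then for every `δ` close enough to `a i₀` there is `x ∈ S` on the hyperplane `{x i₀ = δ}` with `F x = F a`.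
(Open-mapping form of the inverse function theorem for `x ↦ (F x, x i₀)`.) [folklore] -/
theorem eventually_exists_mem_level (F : (ι → 𝕜) → 𝕜) {F' : (ι → 𝕜) →L[𝕜] 𝕜} {a : ι → 𝕜}
    (hF : HasStrictFDerivAt F F' a) {i₀ j : ι} (hj : j ≠ i₀) (hFj : F' (Pi.single j 1) ≠ 0)
    {S : Set (ι → 𝕜)} (hS : S ∈ 𝓝 a) :
    ∀ᶠ δ in 𝓝 (a i₀), ∃ x ∈ S, x i₀ = δ ∧ F x = F a := by
  have hπ : HasStrictFDerivAt (fun x : ι → 𝕜 => x i₀)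
      (ContinuousLinearMap.proj i₀ : (ι → 𝕜) →L[𝕜] 𝕜) a :=
    (ContinuousLinearMap.proj i₀ : (ι → 𝕜) →L[𝕜] 𝕜).hasStrictFDerivAt
  have hΨ : HasStrictFDerivAt (fun x : ι → 𝕜 => (F x, x i₀))
      (F'.prod (ContinuousLinearMap.proj i₀ : (ι → 𝕜) →L[𝕜] 𝕜)) a := hF.prodMk hπ
  have hmap := hΨ.map_nhds_eq_of_surj (range_prod_proj_eq_top F' hj hFj)
  have hT : (fun x : ι → 𝕜 => (F x, x i₀)) '' S ∈ 𝓝 (F a, a i₀) := by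
    rw [← hmap]
    exact image_mem_map hS
  have hpath : Tendsto (fun δ : 𝕜 => (F a, δ)) (𝓝 (a i₀)) (𝓝 (F a, a i₀)) :=
    tendsto_const_nhds.prodMk_nhds tendsto_id
  filter_upwards [hpath.eventually_mem hT] with δ hδ
  obtain ⟨x, hxS, hx⟩ := hδ
  simp only [Prod.mk.injEq] at hx
  exact ⟨x, hxS, hx.2, hx.1⟩

/-- **ENGINE (set form).**  Under the hypotheses of `eventually_exists_mem_level`, every neighbourhood `S`
of `a` contains a point `x` OFF the hyperplane `{x i₀ = a i₀}` with `F x = F a`. [folklore] -/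
theorem exists_mem_nhds_off_coord (F : (ι → 𝕜) → 𝕜) {F' : (ι → 𝕜) →L[𝕜] 𝕜} {a : ι → 𝕜}
    (hF : HasStrictFDerivAt F F' a) {i₀ j : ι} (hj : j ≠ i₀) (hFj : F' (Pi.single j 1) ≠ 0)
    {S : Set (ι → 𝕜)} (hS : S ∈ 𝓝 a) :
    ∃ x ∈ S, x i₀ ≠ a i₀ ∧ F x = F a := by
  have hev := (eventually_exists_mem_level F hF hj hFj hS).filter_mono
    (nhdsWithin_le_nhds (s := ({a i₀}ᶜ : Set 𝕜)))
  obtain ⟨δ, ⟨x, hxS, hxi, hxF⟩, hδ⟩ := (hev.and self_mem_nhdsWithin).exists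
  exact ⟨x, hxS, by rw [hxi]; exact Set.mem_compl_singleton_iff.mp hδ, hxF⟩

/-- **ENGINE (pointwise form with an open side condition).**  `F` strictly differentiable at `a` with
`F'(e_j) ≠ 0` (`j ≠ i₀`), `G` continuous at `a` with `G a ≠ 0` ⟹ there is `x` with `x i₀ ≠ a i₀`,
`F x = F a` and `G x ≠ 0`. [folklore] -/
theorem exists_off_coord_of_ne (F G : (ι → 𝕜) → 𝕜) {F' : (ι → 𝕜) →L[𝕜] 𝕜} {a : ι → 𝕜}
    (hF : HasStrictFDerivAt F F' a) {i₀ j : ι} (hj : j ≠ i₀) (hFj : F' (Pi.single j 1) ≠ 0)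
    (hG : ContinuousAt G a) (hGa : G a ≠ 0) :
    ∃ x : ι → 𝕜, x i₀ ≠ a i₀ ∧ F x = F a ∧ G x ≠ 0 := by
  have hS : {x : ι → 𝕜 | G x ≠ 0} ∈ 𝓝 a := hG.preimage_mem_nhds (isOpen_ne.mem_nhds hGa)
  obtain ⟨x, hxS, hxi, hxF⟩ := exists_mem_nhds_off_coord F hF hj hFj hS
  exact ⟨x, hxi, hxF, hxS⟩

end Engine

section Polynomial

open MvPolynomial

variable {ι : Type*} [Fintype ι] [DecidableEq ι]

omit [Fintype ι] in
/-- The derivative of `t ↦ P(a + t·e_j)` at `t = 0` is `(∂_j P)(a)`. [folklore] -/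
theorem hasDerivAt_eval_line (P : MvPolynomial ι ℂ) (a : ι → ℂ) (j : ι) :
    HasDerivAt (fun t : ℂ => eval (a + t • Pi.single j (1 : ℂ)) P) (eval a (pderiv j P)) 0 := by
  induction P using MvPolynomial.induction_on with
  | C c =>
    simp only [eval_C, pderiv_C]
    exact hasDerivAt_const 0 c
  | add p q hp hq =>
    simp only [map_add]
    exact hp.add hq
  | mul_X p i hp =>
    have hw : HasDerivAt (fun t : ℂ => (a + t • (Pi.single j (1 : ℂ) : ι → ℂ)) i)
        ((Pi.single j (1 : ℂ) : ι → ℂ) i) 0 := by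
      have h1 : HasDerivAt (fun t : ℂ => a i + t * (Pi.single j (1 : ℂ) : ι → ℂ) i)
          ((Pi.single j (1 : ℂ) : ι → ℂ) i) 0 := by
        simpa using (hasDerivAt_mul_const ((Pi.single j (1 : ℂ) : ι → ℂ) i)).const_add (a i)
      refine h1.congr_of_eventuallyEq (Eventually.of_forall fun t => ?_)
      simp
    have hprod := hp.mul hw
    have h0 : (a + (0 : ℂ) • Pi.single j (1 : ℂ)) = a := by simp
    simp only [map_mul, eval_X]
    refine hprod.congr_deriv ?_
    rw [h0, (pderiv j).leibniz, smul_eq_mul, smul_eq_mul, map_add, map_mul, map_mul, eval_X,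
      pderiv_X]
    by_cases hij : j = i
    · subst hij
      simp
      ring
    · simp [Ne.symm hij]
      ring

/-- The Fréchet derivative of `x ↦ P(x)` at `a` evaluated on the coordinate vector `e_j` is `(∂_j P)(a)`.
[folklore] -/
theorem fderiv_eval_apply_single (P : MvPolynomial ι ℂ) (a : ι → ℂ) (j : ι) :
    fderiv ℂ (fun x : ι → ℂ => eval x P) a (Pi.single j 1) = eval a (pderiv j P) := by
  have hF : HasFDerivAt (fun x : ι → ℂ => eval x P) (fderiv ℂ (fun x : ι → ℂ => eval x P) a) a :=
    ((AnalyticOnNhd.eval_mvPolynomial P) a (Set.mem_univ a)).differentiableAt.hasFDerivAt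
  have hL : HasDerivAt (fun t : ℂ => a + t • Pi.single j (1 : ℂ)) (Pi.single j (1 : ℂ)) 0 := by
    simpa using ((hasDerivAt_id (0 : ℂ)).smul_const (Pi.single j (1 : ℂ))).const_add a
  have hcomp : HasDerivAt (fun t : ℂ => eval (a + t • Pi.single j (1 : ℂ)) P)
      (fderiv ℂ (fun x : ι → ℂ => eval x P) a (Pi.single j 1)) 0 :=
    hF.comp_hasDerivAt_of_eq 0 hL (by simp)
  exact hcomp.unique (hasDerivAt_eval_line P a j)

/-- ★ **Curve selection at a smooth point, polynomial form.**  For `P, Q ∈ ℂ[x_ι]` and a point `a` with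
`(∂_j P)(a) ≠ 0` for some coordinate `j ≠ i₀` and `Q(a) ≠ 0`, there is a point `x` OFF the hyperplane
`{x i₀ = a i₀}` on the level set `{P = P(a)}` with `Q(x) ≠ 0`.  (In the scaling-closure argument: `i₀` is the
scaling parameter `δ`, `a` a zero of the shadow at `δ = 0`, `Q` a Hessian minor.) [folklore] -/
theorem exists_off_coord_mvPolynomial (P Q : MvPolynomial ι ℂ) (a : ι → ℂ) {i₀ j : ι} (hj : j ≠ i₀)
    (hPj : eval a (pderiv j P) ≠ 0) (hQ : eval a Q ≠ 0) :
    ∃ x : ι → ℂ, x i₀ ≠ a i₀ ∧ eval x P = eval a P ∧ eval x Q ≠ 0 := by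
  have hF : HasStrictFDerivAt (fun x : ι → ℂ => eval x P) (fderiv ℂ (fun x : ι → ℂ => eval x P) a) a :=
    ((AnalyticOnNhd.eval_mvPolynomial P) a (Set.mem_univ a)).hasStrictFDerivAt
  have hFj : fderiv ℂ (fun x : ι → ℂ => eval x P) a (Pi.single j 1) ≠ 0 := by
    rwa [fderiv_eval_apply_single]
  exact exists_off_coord_of_ne (fun x => eval x P) (fun x => eval x Q) hF hj hFj
    (continuous_eval Q).continuousAt hQ

/-- **Zero-set form** (the shape used downstream): if `P(a) = 0`, `(∂_j P)(a) ≠ 0` for some `j ≠ i₀` and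
`Q(a) ≠ 0`, then `P` has a zero `x` with `x i₀ ≠ a i₀` and `Q(x) ≠ 0`. [folklore] -/
theorem exists_zero_off_coord_mvPolynomial (P Q : MvPolynomial ι ℂ) (a : ι → ℂ) {i₀ j : ι} (hj : j ≠ i₀)
    (hPa : eval a P = 0) (hPj : eval a (pderiv j P) ≠ 0) (hQ : eval a Q ≠ 0) :
    ∃ x : ι → ℂ, x i₀ ≠ a i₀ ∧ eval x P = 0 ∧ eval x Q ≠ 0 := by
  obtain ⟨x, hxi, hxP, hxQ⟩ := exists_off_coord_mvPolynomial P Q a hj hPj hQ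
  exact ⟨x, hxi, hxP.trans hPa, hxQ⟩

end Polynomial

end Summit.ValiantsHypothesis.ValiantsHypothesis.Theorems.GrenetZeonTwoDimCoefficients.ScalingClosure

end
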